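/-
COR-CM (cell pub-hodgecm2, stage 2 of the Hodge ladder) — count-neutral KERNEL COMBINATORICS «the dihedral law», block count: `β(D(ℤ/2n))` for `n` a power
of two (seat prover-pub-hodgecm2-b23-g48-0, binder prover b23, gen 48; claim «DIHEDRAL LAW», HOME/INBOX.md l.22267).  Theorems only, on part Ia
(`Census/DihedralDatum.lean`) and seat b23 gen 46ʼs Burnside count for coset involutions (`IndexTwoDescent.card_block_mul_card_of_coset_involutions`,
`Census/IndexTwoSplitDihedralFloor.lean`) BY NAME; no `decide` beyond closed numerals, no certificate, no named fact, no `sorry`; `Interfaces.lean` (C1),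
every E term, B01, `Transposition/*`, `PortJoin/*`, `D2Bridge/*` untouched.
HONEST FRAMING: `HC_CM` is NOT proved, here or anywhere in the tree; nothing here is a period, a count of record or a headline.
T5: n/a-class (hypothesis binders = the fields of `Dihedral.Datum`; checker: self).
-/
import Summits.HodgeConjecture.CorCM.Census.DihedralDatum
import Summits.HodgeConjecture.CorCM.Census.IndexTwoSplitDihedralFloor

/-!
# The dihedral law, block count: `β(D(ℤ/2n)) · 4n = 4ⁿ + 2n · 2ⁿ` for `n` a power of two

For a dihedral datum `D` on `(G, c)` (`G ≅ D(ℤ/2n)`, `|G| = 4n`) seat b23 gen 46ʼs Burnside count reads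
`β·|G| = Σ_{h ∈ ⟨g⟩} [c ∉ ⟨h⟩]·2^{|G|/(2·ord h)} + (|G|/2)·2^{|G|/4}`.  When `n = 2ᵃ` is a power of two, EVERY rotation `h ≠ 1` has even order in
the cyclic group `⟨g⟩` of order `2^{a+1}`, so `c = gⁿ` (the unique rotation of order two) is a power of `h` (`c_mem_zpowers_pow`): only `h = 1`
contributes, with `2^{2n} = 4ⁿ`.  Hence

* `card_eq_four_mul`: `|G| = 4n`;
* **`card_block_mul_of_two_pow`**: `β · 4n = 4ⁿ + 2n · 2ⁿ` for `n = 2ᵃ`, i.e. `β = 4^{n−1}/n + 2^{n−1}`;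
* rows: **`card_block_eq_four`** (`n = 2`, `D₄`: `β = 4`), **`card_block_eq_twentyFour`** (`n = 4`, `D₈` of order `16`: `β = 24`),
  **`card_block_eq_2176`** (`n = 8`, `D₁₆` of order `32`: `β = 2176`) — so the dihedral law (`Census/DihedralLaw.lean`) gives `μ = 2, 22, 2174`.

## References
* [Pohlmann1968] H. Pohlmann, Algebraic cycles on abelian varieties of complex multiplication type, Ann. of Math. 88 (1968), Thm 1.
* [Milne1999] J. S. Milne, Lefschetz motives and the Tate conjecture, Compositio Math. 117 (1999), Prop. 2.1, p. 54.
-/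

namespace Summit.HodgeConjecture.CorCM.Census.Dihedral

open Finset
open Summit.HodgeConjecture.CorCM.Prior.AllgGroup.RfwfAllgGroup
open Summit.HodgeConjecture.CorCM.Census.BlockParity

noncomputable section

variable {G : Type*} [Group G] [Fintype G] [DecidableEq G] {c : G} {n : ℕ} [NeZero n]
variable (D : Datum G c n)

omit [DecidableEq G] [NeZero n] in
include D in
/-- **`|G| = 4n`.** [folklore] -/
theorem card_eq_four_mul : Fintype.card G = 4 * n := by
  have h := (Subgroup.zpowers D.g).card_mul_index
  rw [Nat.card_zpowers, D.hord, D.hindex, Nat.card_eq_fintype_card] at h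
  omega

omit [Fintype G] [DecidableEq G] [NeZero n] in
/-- `c` lies in the rotation subgroup. [folklore] -/
theorem c_mem_zpowers_g : c ∈ Subgroup.zpowers D.g := by
  have h : D.g ^ n ∈ Subgroup.zpowers D.g := Subgroup.pow_mem _ (Subgroup.mem_zpowers _) n
  rwa [D.hgn] at h

omit [Fintype G] [DecidableEq G] [NeZero n] in
/-- **For `n = 2ᵃ`, `c` is a power of every non-trivial rotation `gᵏ`** (`0 < k < 2n`): writing `k = 2ᵛ·m` with `m` odd, `v ≤ a` and
`(gᵏ)^{2^{a−v}} = g^{m·n} = cᵐ = c`. [folklore] -/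
theorem c_mem_zpowers_pow (hc2 : c * c = 1) {a : ℕ} (ha : n = 2 ^ a) {k : ℕ} (hk0 : k ≠ 0) (hk : k < 2 * n) :
    c ∈ Subgroup.zpowers (D.g ^ k) := by
  obtain ⟨v, m, hm, rfl⟩ := Nat.exists_eq_two_pow_mul_odd hk0
  -- `v ≤ a` since `2^v ≤ 2^v * m < 2 * n = 2^(a+1)`
  have hm1 : 1 ≤ m := hm.pos
  have hva : v ≤ a := by
    have h1 : 2 ^ v < 2 ^ (a + 1) := by
      calc 2 ^ v ≤ 2 ^ v * m := Nat.le_mul_of_pos_right _ hm1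
        _ < 2 * n := hk
        _ = 2 ^ (a + 1) := by rw [ha, pow_succ, mul_comm]
    exact Nat.le_of_lt_succ ((Nat.pow_lt_pow_iff_right (by norm_num)).mp h1)
  refine Subgroup.mem_zpowers_iff.mpr ⟨(2 ^ (a - v) : ℕ), ?_⟩
  rw [zpow_natCast, ← pow_mul]
  have e : 2 ^ v * m * 2 ^ (a - v) = n * m := by
    rw [ha, mul_comm (2 ^ v) m, mul_assoc, ← pow_add, Nat.add_sub_cancel' hva, mul_comm]
  rw [e, pow_mul, D.hgn]
  -- `c ^ m = c` for odd `m`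
  obtain ⟨j, rfl⟩ := hm
  rw [pow_succ, pow_mul, pow_two, hc2, one_pow, one_mul]

omit [NeZero n] in
include D in
/-- **THE BLOCK COUNT FOR `n = 2ᵃ`: `β · 4n = 4ⁿ + 2n · 2ⁿ`.** [folklore] -/
theorem card_block_mul_of_two_pow (hc2 : c * c = 1) (hc1 : c ≠ 1) {a : ℕ} (ha : n = 2 ^ a) :
    Fintype.card (Block c) * (4 * n) = 4 ^ n + 2 * n * 2 ^ n := by
  classical
  have hcard := card_eq_four_mul D
  have h := IndexTwoDescent.card_block_mul_card_of_coset_involutions (c_mem_zpowers_g D) hc2 hc1 D.hcen D.hindex D.hinvol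
  rw [hcard] at h
  -- only `g = 1` contributes to the rotation sum
  have hsum : (∑ g ∈ univ.filter (fun g : G => g ∈ Subgroup.zpowers D.g),
      if c ∈ Subgroup.zpowers g then 0 else 2 ^ (4 * n / orderOf g / 2)) = 4 ^ n := by
    rw [Finset.sum_eq_single_of_mem (1 : G) (Finset.mem_filter.mpr ⟨Finset.mem_univ _, Subgroup.one_mem _⟩)]
    · rw [if_neg, orderOf_one, Nat.div_one, show 4 * n / 2 = 2 * n by omega, pow_mul]
      · norm_num
      · rw [Subgroup.zpowers_one_eq_bot, Subgroup.mem_bot]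
        exact hc1
    · intro g hg hg1
      obtain ⟨k, hk, rfl | rfl⟩ := D.exists_pow_or_pow_mul_s g
      · have hk0 : k ≠ 0 := fun h0 => hg1 (by rw [h0, pow_zero])
        rw [if_pos (c_mem_zpowers_pow D hc2 ha hk0 hk)]
      · exact absurd (Finset.mem_filter.mp hg).2 (D.pow_mul_s_notMem k)
  rw [hsum, show 4 * n / 2 = 2 * n by omega, show 4 * n / 4 = n by omega] at h
  exact h

/-- **Row `n = 2` (`D₄`, order `8`, `c = r²`): `β = 4`.** [folklore] -/
theorem card_block_eq_four (D : Datum G c 2) (hc2 : c * c = 1) (hc1 : c ≠ 1) :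
    Fintype.card (Block c) = 4 := by
  have h := card_block_mul_of_two_pow D hc2 hc1 (a := 1) (by norm_num)
  omega

/-- **Row `n = 4` (`D₈`, order `16`, `c = r⁴`): `β = 24`.** [folklore] -/
theorem card_block_eq_twentyFour (D : Datum G c 4) (hc2 : c * c = 1) (hc1 : c ≠ 1) :
    Fintype.card (Block c) = 24 := by
  have h := card_block_mul_of_two_pow D hc2 hc1 (a := 2) (by norm_num)
  omega

/-- **Row `n = 8` (`D₁₆`, order `32`, `c = r⁸`): `β = 2176`.** [folklore] -/
theorem card_block_eq_2176 (D : Datum G c 8) (hc2 : c * c = 1) (hc1 : c ≠ 1) :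
    Fintype.card (Block c) = 2176 := by
  have h := card_block_mul_of_two_pow D hc2 hc1 (a := 3) (by norm_num)
  omega

end

end Summit.HodgeConjecture.CorCM.Census.Dihedral
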